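/-
Copyright (c) 2026 the pub-hodgecm-mathlib formalisation cell (harness21).  Prover seat hodgecm-mathlib-K2Liu-p07 (g3), Track B «K2-LIT»,
#184♮ = hLiu418 = `stmt-HodgeConjecture-24832`; #42S payer road, organ S1 (local Siegel–Weil spanning), ROAD W, file F5′-C2 (LEAD F0P6-plan (g14)
RULING «M-158a» (4) + BATCH #2: spec (iii) of K2Liu-p06 (g4) 10:31:36Z (2), the Kudla–CM data of record).
-/
import Summits.HodgeConjecture.HodgeConjecture.Theorems.K2LiuLocalSWSimilitudeSymplectic   -- ★ F5′-A2: `exists_symplectic_dA`, `map_deltaLagrangian_symplectic_dA` (+ A1)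
import Summits.HodgeConjecture.HodgeConjecture.Theorems.K2LiuLocalSWSimilitudeRigidity     -- ★ F5′-B: `localSplittingDatumCM_comp_eq_scaleTransportSection`
import Summits.HodgeConjecture.HodgeConjecture.Theorems.K2LiuLocalSWSectionDefs            -- ★ D-A: `swSectionLoc`
import Literature.NumberTheory.GelbartRogawski1991.LocalSplittingCMGaloisTransportRigidity  -- ★ `exists_mover_deltaLagrangian`
import HarnessLib

/-!
# Crux `HLiu418`, #42S organ S1, ROAD W, file F5′-C2: THE KUDLA–CM WEIL DATUM OF `(𝔻, a·h)` IS THE `Ad(d_a)`-CONJUGATE OF THE DATUM OF `(𝔻, h)` —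
# `ω(Σ_χ(d_a g d_a⁻¹)) = ω(P̃_a) ∘ ω′(Σ′_χ(g)) ∘ ω(P̃_a)⁻¹` and the Siegel–Weil sections `F_Φ ∘ Ad(d_a) = F′_{ω(P̃_a)⁻¹Φ}`

Cell `hodgecm-mathlib`, crux item hLiu418 = `stmt-HodgeConjecture-24832`; squad K2 ∕ K2Liu; LEAD F0P6-plan (g14), organ lead K2Liu-p06 (g4); prover
K2Liu-p07 (g3).  THEOREMS ONLY (no `def`, no instance, no notation, no named-fact hypothesis, no `sorry`); lane `--supports stmt-HodgeConjecture-24832 --as helper`.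

WHY (ruling «M-158a» (4): `R₂(V⁻_v) = D_a R₂(V⁺_v)` for the Kudla–CM data OF RECORD).  For a diagonal invertible `T₀ = diag t` over `L⁺` (`0 < n`) and `a ∈ (L⁺)ˣ`, let
`Σ = Σ_χ^{T₀}` and `Σ′ = Σ_χ^{a·T₀}` be the doubled CM Weil sections (★ `localSplittingDatumCM`) and `d_a = (1 on Δ, a on ∇)` the `Δ`-similitude (the letter `DA` of
★ F5′-A1, `Ad(d_a) = localCongr … DA …`).  By ★ F5′-B (rigidity), with (h1) ★ P3b `conj_iota_lineDelta_eq_iota_localCongr_kd`, (h2) ★ F5′-A2 `map_deltaLagrangian_symplectic_dA`,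
(h3)(h4)(h5) ★ F5′-A1, for every lift `P̃_a` of `P_a = Res(DA_v) ∘ e′_a⁻¹`:
* **`localSplitting_localCongr_dA_eq`**: `Σ(d_a g d_a⁻¹) = P̃_a · scaleTransport_a(Σ′)(g) · P̃_a⁻¹`; hence (★ `toRep_scaleTransportSection`: same operators)
  **`toRep_localSplitting_localCongr_dA`**: `ω(Σ(d_a g d_a⁻¹)) Φ = ω(P̃_a) (ω′(Σ′(g′)) (ω(P̃_a)⁻¹ Φ))`, `g′ = scaleInl g` (= `g`, retyped into `U(a·J^𝔻)(L⁺_v)`);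
* **`exists_mover_swSectionLoc_localCongr_dA`**: for every mover-implementer `m₀` of the `T₀`-model there is a mover-implementer `m₀′` of the `a·T₀`-model (the one
  transporting to `m₀ P̃_a`, ★ `exists_scaleTransportElt_eq`; it is a mover because `e′_a` and `P_a` fix `ℓ_Δ`, `ℓ_Y`) with
  **`F^{Σ, m₀}_Φ(d_a g d_a⁻¹) = F^{Σ′, m₀′}_{ω(P̃_a)⁻¹Φ}(g′)`** for ALL `Φ`, `g` (★ `swSectionLoc`) — and conversely every `F^{Σ′, m₀′}_Ψ` is a `F^{Σ,m₀}_Φ ∘ Ad(d_a)`.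
The tensor instantiation (`g = h ⊗ 1_{V′}`, `Ad(d_a ⊗ 1)(h ⊗ 1) = (Ad(d_a) h) ⊗ 1`, frames `dV′` and `a•dV′`) and the `localSWImage` identity are the sequel F5′-C3.
NO Weil-index value, NO β-ratio, NO κ enters; NO character is left over.
References: [Kudla1994] §3 Thm. 3.1; [HarrisKudlaSweet1996] §1 (1.11)–(1.16); [MoeglinVignerasWaldspurger1987] Chap. 2 II.1 (`ψ ↦ ψ_a`), Chap. 3 I.1–I.3; [KudlaRallis1994] §1.
HONEST LABEL.  Count-neutral helper: `HC_CM` is proved only modulo the 7 printed citations (2 remaining named inputs: hLiu418 = `stmt-HodgeConjecture-24832`,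
h413 = `stmt-HodgeConjecture-24833`) until rung 0 closes.
-/

set_option autoImplicit false
set_option linter.dupNamespace false -- the mandated namespace repeats `HodgeConjecture.HodgeConjecture`

noncomputable section

open scoped Matrix
open NumberField IsDedekindDomain MeasureTheory Matrix
open Literature.RepresentationTheory.HeisenbergGroup
open Literature.NumberTheory.Automorphic Literature.NumberTheory.Automorphic.UnitaryGroup Literature.NumberTheory.Weil1964
open Literature.NumberTheory.GaloisRepresentations Literature.RepresentationTheory.HarrisKudlaSweet1996
open Literature.NumberTheory.GelbartRogawski1991 Literature.NumberTheory.GelbartRogawski1991.GRConstruction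
open Literature.NumberTheory.GelbartRogawski1991.AdaptedBlocks
open Literature.NumberTheory.GelbartRogawski1991.UnitaryDualPair Literature.NumberTheory.GelbartRogawski1991.UnitaryDualPair.LocalSplitting
open Summit.HodgeConjecture.HodgeConjecture.Cruxes.HLiu418.K2LiuLocalSWSimilitudeAlgebra
open Summit.HodgeConjecture.HodgeConjecture.Cruxes.HLiu418.K2LiuLocalSWSimilitudeSymplectic
open Summit.HodgeConjecture.HodgeConjecture.Cruxes.HLiu418.K2LiuLocalSWSimilitudeRigidity
open Summit.HodgeConjecture.HodgeConjecture.Cruxes.HLiu418.K2LiuLocalSWSectionDefs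

namespace Summit.HodgeConjecture.HodgeConjecture.Cruxes.HLiu418.K2LiuLocalSWSimilitudeTransport

variable (L : Type) [Field L] [NumberField L] [IsCMField L] (v : HeightOneSpectrum (𝓞 (Fp L)))
  [MeasurableSpace (v.adicCompletion (Fp L))] [BorelSpace (v.adicCompletion (Fp L))]
  (μ : Measure (v.adicCompletion (Fp L))) [μ.IsAddHaarMeasure]
  (n : ℕ) {T₀ T₀' : Matrix (Fin n) (Fin n) (Fp L)} (hn : 0 < n)
  (t : Fin n → Fp L) (hT₀t : T₀ = Matrix.diagonal t) (hT₀ : T₀.IsSymm) (hT₀d : IsUnit T₀.det)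
  (hT₀' : T₀'.IsSymm) (hT₀'d : IsUnit T₀'.det) (a : (Fp L)ˣ) (hTT₀ : T₀' = (a : Fp L) • T₀)
  (χ : HeckeCharacter L) (hχ : IsSplittingChar L 1 χ)
  {D₀ : GL (Fin (n + n)) (Fp L)}
  (hD₀ : (D₀ : Matrix (Fin (n + n)) (Fin (n + n)) (Fp L)) =
    Matrix.reindex (e₂ n) (e₂ n) (cayR (Fp L) (Fin n) * Matrix.fromBlocks 1 0 0 ((a : Fp L) • (1 : Matrix (Fin n) (Fin n) (Fp L))) * cayRinv (Fp L) (Fin n)))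
  {DA : GL (Fin (n + n)) L} (hDA : DA = Matrix.GeneralLinearGroup.map (algebraMap (Fp L) L) D₀)
  (Psp : LocalSp (Fp L) (n + n) (gramD (Fp L) n T₀) v)
  (hPsp : ((Psp : LocalSp (Fp L) (n + n) (gramD (Fp L) n T₀) v) : ((Fin (n + n) → v.adicCompletion (Fp L)) × (Fin (n + n) → v.adicCompletion (Fp L))) ≃ₗ[v.adicCompletion (Fp L)]
        ((Fin (n + n) → v.adicCompletion (Fp L)) × (Fin (n + n) → v.adicCompletion (Fp L)))) =
    (lineScale (unitAt (Fp L) a v)).symm ≪≫ₗ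
      (isQuadraticCoordinates_local L v (IsCMField.complexConj L) (complexConj_imagUnit L) (imagUnit_ne_zero L) (imagUnit_mul_self L)).resAut
        (Fin (n + n)) (toLocalGL L v DA))
  (P : LocalMp (Fp L) (n + n) (gramD (Fp L) n T₀) v) (hP : MpPsi.proj _ P = Psp)

set_option synthInstance.maxHeartbeats 400000 in
set_option maxHeartbeats 4000000 in -- as ★ P3c ∕ ★ F5′-B: the doubled CM telescopes in the STATEMENT elaborate slowly; the proof is plumbing
include hn hT₀t hD₀ hDA hPsp hP in
/-- **`Σ_χ(d_a g d_a⁻¹) = P̃_a · scaleTransport_a(Σ′_χ)(g) · P̃_a⁻¹`** for the doubled CM Weil sections of `T₀ = diag t` and `T₀′ = a·T₀` (★ F5′-B at `θ = Ad(d_a)`,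
with (h1) ★ P3b, (h2) ★ F5′-A2, (h3)–(h5) ★ F5′-A1; a mover of `ℓ_Δ` onto `ℓ_Y` exists by ★ `exists_mover_deltaLagrangian`). [cite: Kudla1994, §3 Thm 3.1]
[cite: HarrisKudlaSweet1996, §1 (1.16)] [cite: MoeglinVignerasWaldspurger1987, Chap. 2 II.1] -/
theorem localSplitting_localCongr_dA_eq
    (g : UnitaryGroup.localPi L (IsCMField.complexConj L) (n + n) ((gramD (Fp L) n T₀).map (algebraMap (Fp L) L)) v) :
    (localSplittingDatumCM L v μ n hT₀ hT₀d rfl χ hχ).localSplitting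
        (localCongr L (IsCMField.complexConj L) DA (inv_ne_zero ((map_ne_zero _).2 a.ne_zero)) (formCongr_dA (Fp L) L (IsCMField.complexConj L) n rfl a hD₀ hDA) v g) =
      P * scaleTransportSection (Fp L) L (IsCMField.complexConj L) (n + n) (complexConj_imagUnit L) (imagUnit_ne_zero L)
        (imagUnit_mul_self L) (gramD (Fp L) n T₀) (gramD (Fp L) n T₀')
        (gramD_isSymm (Fp L) n hT₀) (gramD_isSymm (Fp L) n hT₀') a
        (gramD_of_eq_smul (Fp L) a hTT₀) rfl rfl v
        (localSplittingDatumCM L v μ n hT₀' hT₀'d rfl χ hχ).localSplitting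
        (localSplittingDatumCM L v μ n hT₀' hT₀'d rfl χ hχ).proj_localSplitting g * P⁻¹ := by
  haveI : Algebra.IsQuadraticExtension (Fp L) L := IsCMField.isQuadraticExtension L
  obtain ⟨m, hm⟩ := exists_mover_deltaLagrangian (Fp L) v n hT₀d
  have hb : ((algebraMap (Fp L) L (a : Fp L))⁻¹ : L) ≠ 0 := inv_ne_zero ((map_ne_zero _).2 a.ne_zero)
  have key := localSplittingDatumCM_comp_eq_scaleTransportSection L v μ n hn t hT₀t hT₀ hT₀d hT₀' hT₀'d a hTT₀ χ hχ
    (localCongr L (IsCMField.complexConj L) DA hb (formCongr_dA (Fp L) L (IsCMField.complexConj L) n rfl a hD₀ hDA) v).toMonoidHom Psp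
    (fun g => conj_iota_lineDelta_eq_iota_localCongr_kd (Fp L) L (IsCMField.complexConj L) v n (complexConj_imagUnit L) (imagUnit_ne_zero L)
      (imagUnit_mul_self L) hT₀ hT₀' a hTT₀ rfl rfl hb (formCongr_dA (Fp L) L (IsCMField.complexConj L) n rfl a hD₀ hDA) Psp hPsp g)
    (map_deltaLagrangian_symplectic_dA (Fp L) L (IsCMField.complexConj L) v n a hD₀ hDA (complexConj_imagUnit L) (imagUnit_ne_zero L)
      (imagUnit_mul_self L) Psp hPsp)
    (fun p hp => (isSiegelDelta_localCongr_dA_iff (Fp L) L (IsCMField.complexConj L) v n rfl a hD₀ hDA hb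
      (formCongr_dA (Fp L) L (IsCMField.complexConj L) n rfl a hD₀ hDA) (complexConj_imagUnit L) (imagUnit_ne_zero L) (imagUnit_mul_self L) hT₀ p).2 hp)
    (fun p hp => chiDet_localCongr_dA (Fp L) L (IsCMField.complexConj L) v n rfl a hD₀ hDA hb
      (formCongr_dA (Fp L) L (IsCMField.complexConj L) n rfl a hD₀ hDA) (complexConj_imagUnit L) (imagUnit_ne_zero L) (imagUnit_mul_self L) hT₀ _ hp)
    (fun p hp w' => norm_detDelta_localCongr_dA (Fp L) L (IsCMField.complexConj L) v n rfl a hD₀ hDA hb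
      (formCongr_dA (Fp L) L (IsCMField.complexConj L) n rfl a hD₀ hDA) (complexConj_imagUnit L) (imagUnit_ne_zero L) (imagUnit_mul_self L) hT₀ hp w')
    P hP m hm g
  have key' : P⁻¹ * (localSplittingDatumCM L v μ n hT₀ hT₀d rfl χ hχ).localSplitting
      (localCongr L (IsCMField.complexConj L) DA hb (formCongr_dA (Fp L) L (IsCMField.complexConj L) n rfl a hD₀ hDA) v g) * P = _ := key
  rw [← key']
  simp only [mul_assoc, mul_inv_cancel, mul_one, mul_inv_cancel_left]

set_option synthInstance.maxHeartbeats 400000 in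
set_option maxHeartbeats 4000000 in -- idem
include hn hT₀t hD₀ hDA hPsp hP in
/-- **`ω(Σ_χ(d_a g d_a⁻¹)) Φ = ω(P̃_a) (ω′(Σ′_χ(g′)) (ω(P̃_a)⁻¹ Φ))`**, `g′ = scaleInl g` — the Weil representation of `(𝔻, a·h)` (model `a·T₀`, SAME operators on
`𝒮(L⁺_v^{n+n})` by ★ `toRep_scaleTransportSection`) is the `Ad(d_a)`-conjugate of that of `(𝔻, h)`. [cite: MoeglinVignerasWaldspurger1987, Chap. 2 II.1]
[cite: Kudla1994, §3 Thm 3.1] -/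
theorem toRep_localSplitting_localCongr_dA
    (g : UnitaryGroup.localPi L (IsCMField.complexConj L) (n + n) ((gramD (Fp L) n T₀).map (algebraMap (Fp L) L)) v)
    (Φ : SchwartzBruhat (Fin (n + n) → v.adicCompletion (Fp L))) :
    MpPsi.toRep _ ((localSplittingDatumCM L v μ n hT₀ hT₀d rfl χ hχ).localSplitting
        (localCongr L (IsCMField.complexConj L) DA (inv_ne_zero ((map_ne_zero _).2 a.ne_zero)) (formCongr_dA (Fp L) L (IsCMField.complexConj L) n rfl a hD₀ hDA) v g)) Φ =
      MpPsi.toRep _ P (MpPsi.toRep _ ((localSplittingDatumCM L v μ n hT₀' hT₀'d rfl χ hχ).localSplitting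
        (scaleInl (Fp L) L (IsCMField.complexConj L) (n + n) (gramD (Fp L) n T₀) (gramD (Fp L) n T₀') a (gramD_of_eq_smul (Fp L) a hTT₀) rfl rfl v g))
          (MpPsi.toRep _ P⁻¹ Φ)) := by
  rw [localSplitting_localCongr_dA_eq L v μ n hn t hT₀t hT₀ hT₀d hT₀' hT₀'d a hTT₀ χ hχ hD₀ hDA Psp hPsp P hP g, map_mul, map_mul,
    toRep_scaleTransportSection]
  rfl

set_option synthInstance.maxHeartbeats 400000 in
set_option maxHeartbeats 4000000 in -- idem
include hn hT₀t hD₀ hDA hPsp hP in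
/-- **THE SIEGEL–WEIL SECTIONS TRANSPORT**: for every mover-implementer `m₀` of the `T₀`-model (`π(m₀) ℓ_Δ = ℓ_Y`) there is a mover-implementer `m₀′` of the
`a·T₀`-model with `F^{Σ, m₀}_Φ(d_a g d_a⁻¹) = F^{Σ′, m₀′}_{ω(P̃_a)⁻¹ Φ}(g′)` and `F^{Σ′, m₀′}_Ψ(g′) = F^{Σ, m₀}_{ω(P̃_a) Ψ}(d_a g d_a⁻¹)` for all `Φ`, `Ψ`, `g` (★ `swSectionLoc`):
the `Ad(d_a)`-transport of the Siegel–Weil sections of `(𝔻, h)` are EXACTLY the Siegel–Weil sections of `(𝔻, a·h)`. [cite: KudlaRallis1994, §1] [cite: Kudla1994, §3 Thm 3.1]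
[cite: MoeglinVignerasWaldspurger1987, Chap. 2 II.1] -/
theorem exists_mover_swSectionLoc_localCongr_dA (m₀ : LocalMp (Fp L) (n + n) (gramD (Fp L) n T₀) v)
    (hm₀ : (deltaLagrangian (Fp L) v n).map (toLin (Fp L) v (MpPsi.proj _ m₀)) = lagrangianY (Fp L) (n + n) v) :
    ∃ m₀' : LocalMp (Fp L) (n + n) (gramD (Fp L) n T₀') v,
      (deltaLagrangian (Fp L) v n).map (toLin (Fp L) v (MpPsi.proj _ m₀')) = lagrangianY (Fp L) (n + n) v ∧
      (∀ (Φ : SchwartzBruhat (Fin (n + n) → v.adicCompletion (Fp L)))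
          (g : UnitaryGroup.localPi L (IsCMField.complexConj L) (n + n) ((gramD (Fp L) n T₀).map (algebraMap (Fp L) L)) v),
        swSectionLoc L v (localSplittingDatumCM L v μ n hT₀ hT₀d rfl χ hχ).localSplitting m₀ Φ
            (localCongr L (IsCMField.complexConj L) DA (inv_ne_zero ((map_ne_zero _).2 a.ne_zero)) (formCongr_dA (Fp L) L (IsCMField.complexConj L) n rfl a hD₀ hDA) v g) =
          swSectionLoc L v (localSplittingDatumCM L v μ n hT₀' hT₀'d rfl χ hχ).localSplitting m₀' (MpPsi.toRep _ P⁻¹ Φ)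
            (scaleInl (Fp L) L (IsCMField.complexConj L) (n + n) (gramD (Fp L) n T₀) (gramD (Fp L) n T₀') a (gramD_of_eq_smul (Fp L) a hTT₀) rfl rfl v g)) ∧
      (∀ (Ψ : SchwartzBruhat (Fin (n + n) → v.adicCompletion (Fp L)))
          (g : UnitaryGroup.localPi L (IsCMField.complexConj L) (n + n) ((gramD (Fp L) n T₀).map (algebraMap (Fp L) L)) v),
        swSectionLoc L v (localSplittingDatumCM L v μ n hT₀' hT₀'d rfl χ hχ).localSplitting m₀' Ψ
            (scaleInl (Fp L) L (IsCMField.complexConj L) (n + n) (gramD (Fp L) n T₀) (gramD (Fp L) n T₀') a (gramD_of_eq_smul (Fp L) a hTT₀) rfl rfl v g) =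
          swSectionLoc L v (localSplittingDatumCM L v μ n hT₀ hT₀d rfl χ hχ).localSplitting m₀ (MpPsi.toRep _ P Ψ)
            (localCongr L (IsCMField.complexConj L) DA (inv_ne_zero ((map_ne_zero _).2 a.ne_zero)) (formCongr_dA (Fp L) L (IsCMField.complexConj L) n rfl a hD₀ hDA) v g)) := by
  haveI : Algebra.IsQuadraticExtension (Fp L) L := IsCMField.isQuadraticExtension L
  -- the `a·T₀`-model element transporting to `m₀ P̃`; it is a mover since `P_a` and `e′_a` fix `ℓ_Δ` and `e′_a` fixes `ℓ_Y`
  obtain ⟨m₀', hmm', h1⟩ := exists_scaleTransportElt_eq (Fp L) (n + n) (gramD (Fp L) n T₀) (gramD (Fp L) n T₀') a (gramD_of_eq_smul (Fp L) a hTT₀) v (m₀ * P)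
  have hPΔ : (deltaLagrangian (Fp L) v n).map (toLin (Fp L) v (MpPsi.proj _ P)) = deltaLagrangian (Fp L) v n :=
    hP ▸ map_deltaLagrangian_symplectic_dA (Fp L) L (IsCMField.complexConj L) v n a hD₀ hDA (complexConj_imagUnit L) (imagUnit_ne_zero L)
      (imagUnit_mul_self L) Psp hPsp
  have hmover : (deltaLagrangian (Fp L) v n).map (toLin (Fp L) v (MpPsi.proj _ m₀')) = lagrangianY (Fp L) (n + n) v := by
    have h2 := map_lineScale_deltaLagrangian (F := Fp L) v (n := n) (unitAt (Fp L) a v)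
    have h3 := map_lineScale_symm_lagrangianY (F := Fp L) (n + n) v (unitAt (Fp L) a v)
    rw [h1, Submodule.map_comp, Submodule.map_comp, h2, toLin_proj_mul, Submodule.map_comp, hPΔ, hm₀, h3]
  have hops : ∀ X : SchwartzBruhat (Fin (n + n) → v.adicCompletion (Fp L)),
      MpPsi.toRep _ m₀' X = MpPsi.toRep _ m₀ (MpPsi.toRep _ P X) := by
    intro X
    rw [← toRep_scaleTransportElt (Fp L) (n + n) (gramD (Fp L) n T₀) (gramD (Fp L) n T₀') a (gramD_of_eq_smul (Fp L) a hTT₀) v m₀', hmm', map_mul]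
    rfl
  have hrep := toRep_localSplitting_localCongr_dA L v μ n hn t hT₀t hT₀ hT₀d hT₀' hT₀'d a hTT₀ χ hχ hD₀ hDA Psp hPsp P hP
  have hPP : ∀ Ψ : SchwartzBruhat (Fin (n + n) → v.adicCompletion (Fp L)), MpPsi.toRep _ P⁻¹ (MpPsi.toRep _ P Ψ) = Ψ := fun Ψ => by
    rw [← Module.End.mul_apply, ← map_mul, inv_mul_cancel, map_one, Module.End.one_apply]
  have hfwd : ∀ (Φ : SchwartzBruhat (Fin (n + n) → v.adicCompletion (Fp L)))
      (g : UnitaryGroup.localPi L (IsCMField.complexConj L) (n + n) ((gramD (Fp L) n T₀).map (algebraMap (Fp L) L)) v),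
      swSectionLoc L v (localSplittingDatumCM L v μ n hT₀ hT₀d rfl χ hχ).localSplitting m₀ Φ
          (localCongr L (IsCMField.complexConj L) DA (inv_ne_zero ((map_ne_zero _).2 a.ne_zero)) (formCongr_dA (Fp L) L (IsCMField.complexConj L) n rfl a hD₀ hDA) v g) =
        swSectionLoc L v (localSplittingDatumCM L v μ n hT₀' hT₀'d rfl χ hχ).localSplitting m₀' (MpPsi.toRep _ P⁻¹ Φ)
          (scaleInl (Fp L) L (IsCMField.complexConj L) (n + n) (gramD (Fp L) n T₀) (gramD (Fp L) n T₀') a (gramD_of_eq_smul (Fp L) a hTT₀) rfl rfl v g) := by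
    intro Φ g
    have e₁ := hrep g Φ
    rw [swSectionLoc_apply, swSectionLoc_apply, map_mul, map_mul, Module.End.mul_apply, Module.End.mul_apply, e₁, hops]
  refine ⟨m₀', hmover, hfwd, fun Ψ g => ?_⟩
  have h := hfwd (MpPsi.toRep _ P Ψ) g
  rw [hPP] at h
  exact h.symm

end Summit.HodgeConjecture.HodgeConjecture.Cruxes.HLiu418.K2LiuLocalSWSimilitudeTransport

end
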